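import Summits.Ventures.PercRepro.ProfilePointedCircuitClassesStarSevenFromSharpA

/-!
# PercRepro — (★) AT `(7, 4)` FROM THE SHARP STATEMENT, PART B — THE LIFTS AND THE COUNT TRANSFER
(p5, gen 56; `proofs/P5-GM1.md` §84 ADD 1)

The bi-independent `4`-sets of `N = R ⊕ {b, b′}` are exactly the lifts `Y + b`, `Y + b′` of the bi-independent
`3`-sets `Y` of `R` (`insert_mem_biIndepSets_seriesExt`, `mem_biIndepSets_seriesExt`), every count over `N` is the
sum of two lifted counts (`card_filter_biIndepSets_seriesExt`).
-/

open scoped Matroid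

namespace PercRepro.Cogirth

open Finset ThmH Skew Shadow Profile

open Classical

variable {α : Type} [DecidableEq α]

section StarSevenC

variable {R : Matroid α} [R.Finite] {b b' : α} {h : Disjoint R.E {b, b'}}

omit [DecidableEq α] in
/-- `b, b′ ∉ gr R`. -/
theorem notMem_gr_of_disjoint (h : Disjoint R.E {b, b'}) : b ∉ gr R ∧ b' ∉ gr R := by
  constructor
  · intro hb
    have : b ∈ R.E := by rw [← coe_gr]; exact mem_coe.2 hb
    exact Set.disjoint_left.1 h this (Set.mem_insert _ _)
  · intro hb'
    have : b' ∈ R.E := by rw [← coe_gr]; exact mem_coe.2 hb'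
    exact Set.disjoint_left.1 h this (Set.mem_insert_of_mem _ (Set.mem_singleton _))

/-- The trace of a subset of `N` on `R` and on `{b, b′}` partition it. -/
theorem card_eq_card_inter_add_card_inter {W : Finset α} (hW : W ⊆ gr (seriesExt R b b' h)) :
    W.card = (W ∩ gr R).card + (W ∩ {b, b'}).card := by
  obtain ⟨hb, hb'⟩ := notMem_gr_of_disjoint h
  have hdis : Disjoint (W ∩ gr R) (W ∩ {b, b'}) := by
    rw [disjoint_left]
    intro z hz1 hz2
    have hzR := (mem_inter.1 hz1).2
    have hz2' := (mem_inter.1 hz2).2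
    simp only [mem_insert, mem_singleton] at hz2'
    rcases hz2' with rfl | rfl
    · exact hb hzR
    · exact hb' hzR
  have hunion : W ∩ gr R ∪ W ∩ {b, b'} = W := by
    rw [← inter_union_distrib_left, ← gr_seriesExt (h := h)]
    exact inter_eq_left.2 hW
  rw [← card_union_of_disjoint hdis, hunion]

/-- `(W + p) ∩ gr R = W ∩ gr R` for `p ∈ {b, b′}`... stated for `Y ⊆ gr R`: `(Y + p) ∩ gr R = Y`. -/
theorem insert_inter_gr_eq {Y : Finset α} (hY : Y ⊆ gr R) {p : α} (hp : p ∉ gr R) : insert p Y ∩ gr R = Y := by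
  ext z
  rw [mem_inter, mem_insert]
  constructor
  · rintro ⟨rfl | hz, hzR⟩
    · exact absurd hzR hp
    · exact hz
  · intro hz; exact ⟨Or.inr hz, hY hz⟩

/-- **THE LIFT**: a bi-independent `3`-set `Y` of `R` lifts to the bi-independent `4`-sets `Y + b`, `Y + b′` of `N`. -/
theorem insert_mem_biIndepSets_seriesExt (hn7 : (gr R).card = 7) (hbb' : b ≠ b') {Y : Finset α}
    (hY : Y ∈ biIndepSets R 3) {p : α} (hp : p = b ∨ p = b') :
    insert p Y ∈ biIndepSets (seriesExt R b b' h) 4 := by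
  obtain ⟨hb, hb'⟩ := notMem_gr_of_disjoint h
  obtain ⟨hYg, hY3, hYr, hYc⟩ := mem_biIndepSets.1 hY
  have hpR : p ∉ gr R := by rcases hp with rfl | rfl <;> assumption
  have hpY : p ∉ Y := fun h' => hpR (hYg h')
  have hpN : p ∈ gr (seriesExt R b b' h) := by
    rw [gr_seriesExt]; rcases hp with rfl | rfl
    · exact mem_union_right _ (mem_insert_self _ _)
    · exact mem_union_right _ (mem_insert_of_mem (mem_singleton_self _))
  have hWg : insert p Y ⊆ gr (seriesExt R b b' h) := by
    rw [gr_seriesExt]; exact insert_subset (by rw [← gr_seriesExt]; exact hpN) (hYg.trans subset_union_left)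
  have hW4 : (insert p Y).card = 4 := by rw [card_insert_of_notMem hpY, hY3]
  rw [mem_biIndepSets]
  refine ⟨hWg, hW4, ?_, ?_⟩
  · rw [rk_seriesExt _ hWg, insert_inter_gr_eq hYg hpR, rk_parallelPair_inter, hW4, hYr, hY3]
    have : b ∈ insert p Y ∨ b' ∈ insert p Y := by
      rcases hp with rfl | rfl
      · exact Or.inl (mem_insert_self _ _)
      · exact Or.inr (mem_insert_self _ _)
    rw [if_pos this]
  · -- the complement `(gr R ∖ Y) + p′` with `p′` the other point
    have hsub : gr (seriesExt R b b' h) \ insert p Y ⊆ gr (seriesExt R b b' h) := sdiff_subset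
    rw [rk_seriesExt _ hsub, rk_parallelPair_inter]
    have h1 : (gr (seriesExt R b b' h) \ insert p Y) ∩ gr R = gr R \ Y := by
      ext z
      simp only [mem_inter, mem_sdiff, mem_insert, not_or]
      constructor
      · rintro ⟨⟨-, -, hzY⟩, hzR⟩; exact ⟨hzR, hzY⟩
      · rintro ⟨hzR, hzY⟩
        refine ⟨⟨?_, fun h' => hpR (h' ▸ hzR), hzY⟩, hzR⟩
        rw [gr_seriesExt]; exact mem_union_left _ hzR
    rw [h1, hYc, card_sdiff_of_subset hYg, hn7, hY3]
    have h2 : b ∈ gr (seriesExt R b b' h) \ insert p Y ∨ b' ∈ gr (seriesExt R b b' h) \ insert p Y := by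
      rcases hp with rfl | rfl
      · right
        refine mem_sdiff.2 ⟨by rw [gr_seriesExt]; exact mem_union_right _ (mem_insert_of_mem (mem_singleton_self _)), ?_⟩
        intro h'
        rcases mem_insert.1 h' with h'' | h''
        · exact hbb' h''.symm
        · exact hb' (hYg h'')
      · left
        refine mem_sdiff.2 ⟨by rw [gr_seriesExt]; exact mem_union_right _ (mem_insert_self _ _), ?_⟩
        intro h'
        rcases mem_insert.1 h' with h'' | h''
        · exact hbb' h''
        · exact hb (hYg h'')
    rw [if_pos h2, card_sdiff_of_subset hWg, hW4]
    have h9 : (gr (seriesExt R b b' h)).card = 9 := by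
      rw [gr_seriesExt, card_union_of_disjoint, hn7, card_pair hbb']
      rw [disjoint_left]
      intro z hz hz'
      simp only [mem_insert, mem_singleton] at hz'
      rcases hz' with rfl | rfl
      · exact hb hz
      · exact hb' hz
    rw [h9]

/-- The trace of `W ⊆ gr N` on `{b, b′}` has one point per member. -/
theorem card_inter_pair_eq (hbb' : b ≠ b') (W : Finset α) :
    (W ∩ {b, b'}).card = (if b ∈ W then 1 else 0) + (if b' ∈ W then 1 else 0) := by
  by_cases hb : b ∈ W <;> by_cases hb' : b' ∈ W
  · have : W ∩ {b, b'} = {b, b'} := inter_eq_right.2 (insert_subset hb (singleton_subset_iff.2 hb'))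
    rw [this, card_pair hbb', if_pos hb, if_pos hb']
  · have : W ∩ {b, b'} = {b} := by
      ext z; simp only [mem_inter, mem_insert, mem_singleton]
      constructor
      · rintro ⟨hz, rfl | rfl⟩
        · rfl
        · exact absurd hz hb'
      · rintro rfl; exact ⟨hb, Or.inl rfl⟩
    rw [this, card_singleton, if_pos hb, if_neg hb']
  · have : W ∩ {b, b'} = {b'} := by
      ext z; simp only [mem_inter, mem_insert, mem_singleton]
      constructor
      · rintro ⟨hz, rfl | rfl⟩
        · exact absurd hz hb
        · rfl
      · rintro rfl; exact ⟨hb', Or.inr rfl⟩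
    rw [this, card_singleton, if_neg hb, if_pos hb']
  · have : W ∩ {b, b'} = ∅ := by
      rw [eq_empty_iff_forall_notMem]
      intro z hz
      obtain ⟨hzW, hz'⟩ := mem_inter.1 hz
      simp only [mem_insert, mem_singleton] at hz'
      rcases hz' with rfl | rfl
      · exact hb hzW
      · exact hb' hzW
    rw [this, card_empty, if_neg hb, if_neg hb']

/-- **EVERY BI-INDEPENDENT `4`-SET OF `N` IS A LIFT**: it contains exactly one of `b, b′`, and removing it leaves a
bi-independent `3`-set of `R`. -/
theorem mem_biIndepSets_seriesExt (hn7 : (gr R).card = 7) (hbb' : b ≠ b') {W : Finset α}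
    (hW : W ∈ biIndepSets (seriesExt R b b' h) 4) :
    ∃ Y ∈ biIndepSets R 3, (b ∈ W ∧ b' ∉ W ∧ W = insert b Y) ∨ (b' ∈ W ∧ b ∉ W ∧ W = insert b' Y) := by
  obtain ⟨hb, hb'⟩ := notMem_gr_of_disjoint h
  obtain ⟨hWg, hW4, hWr, hWc⟩ := mem_biIndepSets.1 hW
  have h9 : (gr (seriesExt R b b' h)).card = 9 := by
    rw [gr_seriesExt, card_union_of_disjoint, hn7, card_pair hbb']
    rw [disjoint_left]
    intro z hz hz'
    simp only [mem_insert, mem_singleton] at hz'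
    rcases hz' with rfl | rfl
    · exact hb hz
    · exact hb' hz
  have hbN : b ∈ gr (seriesExt R b b' h) := by rw [gr_seriesExt]; exact mem_union_right _ (mem_insert_self _ _)
  have hb'N : b' ∈ gr (seriesExt R b b' h) := by
    rw [gr_seriesExt]; exact mem_union_right _ (mem_insert_of_mem (mem_singleton_self _))
  set C := gr (seriesExt R b b' h) \ W with hCdef
  have hCg : C ⊆ gr (seriesExt R b b' h) := sdiff_subset
  have hC5 : C.card = 5 := by rw [hCdef, card_sdiff_of_subset hWg, h9, hW4]
  rw [rk_seriesExt _ hWg, rk_parallelPair_inter] at hWr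
  rw [rk_seriesExt _ hCg, rk_parallelPair_inter] at hWc
  have hWs := card_eq_card_inter_add_card_inter hWg
  have hCs := card_eq_card_inter_add_card_inter hCg
  rw [card_inter_pair_eq hbb'] at hWs hCs
  have hWR := rk_le_card' (M := R) (W ∩ gr R)
  have hCR := rk_le_card' (M := R) (C ∩ gr R)
  have hbC : b ∈ C ↔ b ∉ W := by rw [hCdef, mem_sdiff]; exact ⟨fun h' => h'.2, fun h' => ⟨hbN, h'⟩⟩
  have hb'C : b' ∈ C ↔ b' ∉ W := by rw [hCdef, mem_sdiff]; exact ⟨fun h' => h'.2, fun h' => ⟨hb'N, h'⟩⟩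
  -- the complement of `W ∩ gr R` in `gr R` is `C ∩ gr R`
  have hcompl : gr R \ (W ∩ gr R) = C ∩ gr R := by
    ext z
    simp only [mem_sdiff, mem_inter, hCdef, not_and]
    constructor
    · rintro ⟨hzR, hz⟩
      refine ⟨⟨by rw [gr_seriesExt]; exact mem_union_left _ hzR, fun h' => hz h' hzR⟩, hzR⟩
    · rintro ⟨⟨-, hzW⟩, hzR⟩
      exact ⟨hzR, fun h' _ => hzW h'⟩
  by_cases hbW : b ∈ W <;> by_cases hb'W : b' ∈ W
  · -- both in `W`: `W ∩ gr R` has two points, rank ≤ 2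
    simp only [hbW, hb'W, true_or, if_true] at hWr hWs
    rw [hW4] at hWr hWs
    omega
  · -- `b ∈ W`, `b′ ∉ W`
    have hb'C' : b' ∈ C := hb'C.2 hb'W
    have hbC' : b ∉ C := fun h' => hbC.1 h' hbW
    simp only [hbW, hb'W, true_or, if_true, if_false] at hWr hWs
    simp only [hbC', hb'C', or_true, if_true, if_false] at hWc hCs
    rw [hW4] at hWr hWs
    rw [hC5] at hWc hCs
    refine ⟨W ∩ gr R, ?_, Or.inl ⟨hbW, hb'W, ?_⟩⟩
    · rw [mem_biIndepSets]
      refine ⟨inter_subset_right, by omega, by omega, ?_⟩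
      rw [hcompl]; omega
    · ext z
      rw [mem_insert, mem_inter]
      constructor
      · intro hz
        by_cases hzb : z = b
        · exact Or.inl hzb
        · right
          refine ⟨hz, ?_⟩
          have := hWg hz
          rw [gr_seriesExt, mem_union] at this
          rcases this with h' | h'
          · exact h'
          · simp only [mem_insert, mem_singleton] at h'
            rcases h' with rfl | rfl
            · exact absurd rfl hzb
            · exact absurd hz hb'W
      · rintro (rfl | ⟨hz, -⟩)
        · exact hbW
        · exact hz
  · -- `b′ ∈ W`, `b ∉ W`
    have hbC' : b ∈ C := hbC.2 hbW
    have hb'C' : b' ∉ C := fun h' => hb'C.1 h' hb'W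
    simp only [hbW, hb'W, or_true, if_true, if_false] at hWr hWs
    simp only [hbC', hb'C', true_or, if_true, if_false] at hWc hCs
    rw [hW4] at hWr hWs
    rw [hC5] at hWc hCs
    refine ⟨W ∩ gr R, ?_, Or.inr ⟨hb'W, hbW, ?_⟩⟩
    · rw [mem_biIndepSets]
      refine ⟨inter_subset_right, by omega, by omega, ?_⟩
      rw [hcompl]; omega
    · ext z
      rw [mem_insert, mem_inter]
      constructor
      · intro hz
        by_cases hzb' : z = b'
        · exact Or.inl hzb'
        · right
          refine ⟨hz, ?_⟩
          have := hWg hz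
          rw [gr_seriesExt, mem_union] at this
          rcases this with h' | h'
          · exact h'
          · simp only [mem_insert, mem_singleton] at h'
            rcases h' with rfl | rfl
            · exact absurd hz hbW
            · exact absurd rfl hzb'
      · rintro (rfl | ⟨hz, -⟩)
        · exact hb'W
        · exact hz
  · -- neither in `W`: both in `C`, whose trace on `gr R` has three points, rank ≤ 3
    have hbC' : b ∈ C := hbC.2 hbW
    have hb'C' : b' ∈ C := hb'C.2 hb'W
    simp only [hbC', hb'C', true_or, if_true] at hWc hCs
    rw [hC5] at hWc hCs
    omega

/-- `#(gr N) = 9`. -/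
theorem card_gr_seriesExt (hn7 : (gr R).card = 7) (hbb' : b ≠ b') : (gr (seriesExt R b b' h)).card = 9 := by
  obtain ⟨hb, hb'⟩ := notMem_gr_of_disjoint h
  rw [gr_seriesExt, card_union_of_disjoint, hn7, card_pair hbb']
  rw [disjoint_left]
  intro z hz hz'
  simp only [mem_insert, mem_singleton] at hz'
  rcases hz' with rfl | rfl
  · exact hb hz
  · exact hb' hz

/-- **THE COUNT TRANSFER**: a count over the bi-independent `4`-sets of `N` is the sum of the two lifted counts. -/
theorem card_filter_biIndepSets_seriesExt (hn7 : (gr R).card = 7) (hbb' : b ≠ b') (Q : Finset α → Prop)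
    [DecidablePred Q] :
    ((biIndepSets (seriesExt R b b' h) 4).filter Q).card =
      ((biIndepSets R 3).filter (fun Y => Q (insert b Y))).card +
        ((biIndepSets R 3).filter (fun Y => Q (insert b' Y))).card := by
  obtain ⟨hb, hb'⟩ := notMem_gr_of_disjoint h
  have hbY : ∀ Y ∈ biIndepSets R 3, b ∉ Y := fun Y hY h' => hb ((mem_biIndepSets.1 hY).1 h')
  have hb'Y : ∀ Y ∈ biIndepSets R 3, b' ∉ Y := fun Y hY h' => hb' ((mem_biIndepSets.1 hY).1 h')
  have hinjb : Set.InjOn (fun Y => insert b Y)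
      (((biIndepSets R 3).filter (fun Y => Q (insert b Y)) : Finset (Finset α)) : Set (Finset α)) := by
    intro Y₁ hY₁ Y₂ hY₂ heq
    have heq' : insert b Y₁ = insert b Y₂ := heq
    have h1 := hbY Y₁ (mem_filter.1 (mem_coe.1 hY₁)).1
    have h2 := hbY Y₂ (mem_filter.1 (mem_coe.1 hY₂)).1
    have : (insert b Y₁).erase b = (insert b Y₂).erase b := by rw [heq']
    rwa [erase_insert h1, erase_insert h2] at this
  have hinjb' : Set.InjOn (fun Y => insert b' Y)
      (((biIndepSets R 3).filter (fun Y => Q (insert b' Y)) : Finset (Finset α)) : Set (Finset α)) := by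
    intro Y₁ hY₁ Y₂ hY₂ heq
    have heq' : insert b' Y₁ = insert b' Y₂ := heq
    have h1 := hb'Y Y₁ (mem_filter.1 (mem_coe.1 hY₁)).1
    have h2 := hb'Y Y₂ (mem_filter.1 (mem_coe.1 hY₂)).1
    have : (insert b' Y₁).erase b' = (insert b' Y₂).erase b' := by rw [heq']
    rwa [erase_insert h1, erase_insert h2] at this
  have hdis : Disjoint (((biIndepSets R 3).filter (fun Y => Q (insert b Y))).image (fun Y => insert b Y))
      (((biIndepSets R 3).filter (fun Y => Q (insert b' Y))).image (fun Y => insert b' Y)) := by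
    rw [disjoint_left]
    intro W hW1 hW2
    obtain ⟨Y₁, hY₁, rfl⟩ := mem_image.1 hW1
    obtain ⟨Y₂, hY₂, hW⟩ := mem_image.1 hW2
    have : b ∈ insert b' Y₂ := by rw [hW]; exact mem_insert_self _ _
    rcases mem_insert.1 this with h' | h'
    · exact hbb' h'
    · exact hbY Y₂ (mem_filter.1 hY₂).1 h'
  have hunion : (biIndepSets (seriesExt R b b' h) 4).filter Q =
      ((biIndepSets R 3).filter (fun Y => Q (insert b Y))).image (fun Y => insert b Y) ∪
        ((biIndepSets R 3).filter (fun Y => Q (insert b' Y))).image (fun Y => insert b' Y) := by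
    ext W
    rw [mem_filter, mem_union, mem_image, mem_image]
    constructor
    · rintro ⟨hW, hQ⟩
      obtain ⟨Y, hY, hcase⟩ := mem_biIndepSets_seriesExt hn7 hbb' hW
      rcases hcase with ⟨-, -, rfl⟩ | ⟨-, -, rfl⟩
      · exact Or.inl ⟨Y, mem_filter.2 ⟨hY, hQ⟩, rfl⟩
      · exact Or.inr ⟨Y, mem_filter.2 ⟨hY, hQ⟩, rfl⟩
    · rintro (⟨Y, hY, rfl⟩ | ⟨Y, hY, rfl⟩)
      · exact ⟨insert_mem_biIndepSets_seriesExt hn7 hbb' (mem_filter.1 hY).1 (Or.inl rfl), (mem_filter.1 hY).2⟩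
      · exact ⟨insert_mem_biIndepSets_seriesExt hn7 hbb' (mem_filter.1 hY).1 (Or.inr rfl), (mem_filter.1 hY).2⟩
  rw [hunion, card_union_of_disjoint hdis, card_image_of_injOn hinjb, card_image_of_injOn hinjb']

end StarSevenC

end PercRepro.Cogirth
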